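import Mathlib
import Summits.AtomisticToContinuum.FouriersLaw.Theorems.EmbeddedDrudeMourreDrudeDissolutionSecondDifferenceSmoothing
import HarnessLib

/-!
# Second differences of a pushforward measure along a transversal direction
(crux `EmbeddedDrudeMourre.DrudeDissolution`, item stmt-AtomisticToContinuum-12593; `--supports` file for the
registered sub-goal `abs_integral_secondDiff_le` of stub B1b″ `stub_excursionSecondDifference` of line
`kinetic-polymer-gas-on-the-time-axis`; closes nothing; lead c13 (process B), 2026-08-17)

WHAT. The generic "chart lemma" behind the second-difference (Besov `B^{1+α}_{1,∞}`) form of the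
time-integrability of the free odd excursion kernel. On a finite-dimensional real vector space `V` with a
Haar measure `μ`, let `G : V → ℝ` be a `C²` amplitude with compact support, `Ω : V → ℝ` a `C³` level
function and `v ∈ V` a direction TRANSVERSAL to the level sets of `Ω` on the support of the amplitude
(`∂_v Ω ≠ 0` on `tsupport G`). Then for every continuous test function `φ` with `|φ| ≤ 1` and every
`δ ≥ 0`,

  `|∫ G · (2φ(Ω) − φ(Ω + δ) − φ(Ω − δ)) dμ| ≤ δ² · ∫ |∂_v((∂_v(G/∂_vΩ))/∂_vΩ)| dμ`     (†)

— the second difference of the pushforward measure `Ω_*(G μ)` tested against `φ` is `O(δ²)`, with a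
constant that does NOT see any derivative of `φ`.

HOW. Integrate `φ` twice (`φ₂'' = φ`; `exists_smoothed_secondDiff` of
`EmbeddedDrudeMourreDrudeDissolutionSecondDifferenceSmoothing`) and put
`Φ(E) = φ₂(E+δ) − 2φ₂(E) + φ₂(E−δ)`: then `Φ'' = φ(·+δ) − 2φ + φ(·−δ)` and `|Φ| ≤ δ²`
(`Φ(E) = ∫_E^{E+δ} (φ₁(u) − φ₁(u−δ)) du`, `|φ₁(u) − φ₁(u−δ)| = |∫_{u−δ}^u φ| ≤ δ`). One integration by
parts along `v` (Mathlib's `integral_mul_fderiv_eq_neg_fderiv_mul_of_integrable`, no boundary terms)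
turns `∫ Ψ'(Ω)·G` into `−∫ Ψ(Ω)·∂_v(G/∂_vΩ)` for any `C¹` pair `Ψ' = dΨ/dE` (`integral_deriv_comp_mul_eq`);
applied twice, `∫ Φ''(Ω) G = ∫ Φ(Ω)·∂_v((∂_v(G/∂_vΩ))/∂_vΩ)`, and (†) follows from `|Φ| ≤ δ²`. The
regularity bookkeeping (`G/∂_vΩ ∈ Cⁿ` with compact support inside `tsupport G`) is the real-valued
copy of `Literature.Analysis.Asymptotics.contDiff_div_phase` (directional non-stationary phase).

WHY (role). In the proof of B1b″ the cell `(−π,π]³` is unfolded to `ℝ³` against a smooth periodic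
partition of unity; every piece supported where some coordinate direction is transversal to `Ω` is
`O(δ²)` by (†) (fixed charts away from the critical set of `Ω`; δ-dependent dyadic charts near it, where
the right-hand side of (†) is estimated by power counting).
-/

noncomputable section

open MeasureTheory Set Filter Function Topology
open scoped Topology ContDiff

namespace Summit.AtomisticToContinuum.FouriersLaw.Theorems.DrudeDissolution.KineticPolymerGasOnTheTimeAxis

/-! ### §2 The amplitude divided by the directional derivative of the level function -/

variable {V : Type*} [NormedAddCommGroup V] [NormedSpace ℝ V]

/-- **`G / ∂_v Ω` is `Cⁿ`** when `Ω ∈ Cⁿ⁺¹`, `G ∈ Cⁿ` and `∂_v Ω ≠ 0` on `tsupport G` (off the support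
the quotient vanishes identically near every point; real-valued copy of
`Literature.Analysis.Asymptotics.contDiff_div_phase`). [folklore] -/
theorem sd_contDiff_div {Ω G : V → ℝ} {n : ℕ} (hΩ : ContDiff ℝ (n + 1) Ω) (hG : ContDiff ℝ n G)
    {v : V} (hv : ∀ y ∈ tsupport G, fderiv ℝ Ω y v ≠ 0) :
    ContDiff ℝ n fun z => G z / fderiv ℝ Ω z v := by
  have hq : ContDiff ℝ n fun z => fderiv ℝ Ω z v :=
    (hΩ.fderiv_right (m := n) (by norm_cast)).clm_apply contDiff_const
  rw [contDiff_iff_contDiffAt]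
  intro y
  by_cases hy : y ∈ tsupport G
  · exact hG.contDiffAt.div hq.contDiffAt (hv y hy)
  · have hG0 : G =ᶠ[𝓝 y] 0 := notMem_tsupport_iff_eventuallyEq.mp hy
    have h0 : (fun z => G z / fderiv ℝ Ω z v) =ᶠ[𝓝 y] fun _ => (0 : ℝ) := by
      filter_upwards [hG0] with z hz
      simp [hz]
    exact (contDiffAt_const (c := (0 : ℝ))).congr_of_eventuallyEq h0

/-- The support of `G / ∂_v Ω` is contained in that of `G`. [folklore] -/
theorem sd_support_div_subset (Ω G : V → ℝ) (v : V) :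
    support (fun z => G z / fderiv ℝ Ω z v) ⊆ support G := fun z hz => by
  rw [mem_support] at hz ⊢
  exact fun hG0 => hz (by rw [hG0, zero_div])

/-- `tsupport (G / ∂_v Ω) ⊆ tsupport G`. [folklore] -/
theorem sd_tsupport_div_subset (Ω G : V → ℝ) (v : V) :
    tsupport (fun z => G z / fderiv ℝ Ω z v) ⊆ tsupport G :=
  closure_mono (sd_support_div_subset Ω G v)

/-- `G / ∂_v Ω` has compact support when `G` has. [folklore] -/
theorem sd_hasCompactSupport_div (Ω : V → ℝ) {G : V → ℝ} (hGs : HasCompactSupport G) (v : V) :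
    HasCompactSupport fun z => G z / fderiv ℝ Ω z v :=
  hGs.mono (sd_support_div_subset Ω G v)

/-- `tsupport (∂_v (G / ∂_v Ω)) ⊆ tsupport G`. [folklore] -/
theorem sd_tsupport_fderiv_div_subset (Ω G : V → ℝ) (v : V) :
    tsupport (fun y => fderiv ℝ (fun z => G z / fderiv ℝ Ω z v) y v) ⊆ tsupport G :=
  (tsupport_fderiv_apply_subset ℝ v).trans (sd_tsupport_div_subset Ω G v)

variable [FiniteDimensional ℝ V] [MeasurableSpace V] [BorelSpace V] {μ : Measure V}
  [μ.IsAddHaarMeasure]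

/-! ### §3 One integration by parts along `v` -/

/-- **One integration by parts along a transversal direction.** For a `C¹` pair `Ψ' = dΨ/dE` on `ℝ`
(`Ψ'` continuous), a `C²` level function `Ω`, a `C¹` amplitude `G` with compact support and a
direction `v` with `∂_v Ω ≠ 0` on `tsupport G`:
`∫ Ψ'(Ω) · G dμ = −∫ Ψ(Ω) · ∂_v(G/∂_vΩ) dμ`. Proof: `∂_v(Ψ∘Ω) = Ψ'(Ω) ∂_vΩ` and `∂_vΩ · (G/∂_vΩ) = G`,
so the left side is `∫ ∂_v(Ψ∘Ω) · (G/∂_vΩ)`; integrate by parts (no boundary terms).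
[cite: HormanderALPDO1, Thm. 7.7.1 (proof, one step)] -/
theorem integral_deriv_comp_mul_eq {Ψ Ψ' : ℝ → ℝ} (hΨ : ∀ E, HasDerivAt Ψ (Ψ' E) E)
    (hΨ'c : Continuous Ψ') {Ω G : V → ℝ} (hΩ : ContDiff ℝ 2 Ω) (hG : ContDiff ℝ 1 G)
    (hGs : HasCompactSupport G) {v : V} (hv : ∀ y ∈ tsupport G, fderiv ℝ Ω y v ≠ 0) :
    ∫ y, Ψ' (Ω y) * G y ∂μ =
      -∫ y, Ψ (Ω y) * fderiv ℝ (fun z => G z / fderiv ℝ Ω z v) y v ∂μ := by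
  set h : V → ℝ := fun z => G z / fderiv ℝ Ω z v with hh
  have hhC : ContDiff ℝ 1 h :=
    sd_contDiff_div (n := 1) (hΩ.of_le (by norm_num)) hG hv
  have hhs : HasCompactSupport h := sd_hasCompactSupport_div Ω hGs v
  have hΨc : Continuous Ψ := continuous_iff_continuousAt.2 fun E => (hΨ E).continuousAt
  have hΨd : Differentiable ℝ Ψ := fun E => (hΨ E).differentiableAt
  have hΩd : Differentiable ℝ Ω := hΩ.differentiable (by norm_num)
  have hΩc : Continuous Ω := hΩ.continuous
  have hΩ'c : Continuous fun y => fderiv ℝ Ω y v :=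
    (hΩ.continuous_fderiv (by norm_num)).clm_apply continuous_const
  have hhd : Differentiable ℝ h := hhC.differentiable one_ne_zero
  have hh'c : Continuous fun y => fderiv ℝ h y v :=
    (hhC.continuous_fderiv one_ne_zero).clm_apply continuous_const
  -- the derivative of `Ψ ∘ Ω` along `v`
  have hf' : ∀ y, fderiv ℝ (fun z => Ψ (Ω z)) y v = Ψ' (Ω y) * fderiv ℝ Ω y v := by
    intro y
    have hc : HasFDerivAt (fun z => Ψ (Ω z)) (Ψ' (Ω y) • fderiv ℝ Ω y) y :=
      (hΨ (Ω y)).comp_hasFDerivAt y (hΩd y).hasFDerivAt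
    rw [hc.fderiv]
    rfl
  have hfd : ∀ y, DifferentiableAt ℝ (fun z => Ψ (Ω z)) y := fun y =>
    ((hΨ (Ω y)).comp_hasFDerivAt y (hΩd y).hasFDerivAt).differentiableAt
  -- integrability of the three products (continuous with compact support)
  have h1 : Integrable (fun y => fderiv ℝ (fun z => Ψ (Ω z)) y v * h y) μ := by
    simp only [hf']
    exact Continuous.integrable_of_hasCompactSupport
      (((hΨ'c.comp hΩc).mul hΩ'c).mul hhC.continuous) hhs.mul_left
  have h2 : Integrable (fun y => Ψ (Ω y) * fderiv ℝ h y v) μ :=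
    Continuous.integrable_of_hasCompactSupport ((hΨc.comp hΩc).mul hh'c)
      (hhs.fderiv_apply ℝ v).mul_left
  have h3 : Integrable (fun y => Ψ (Ω y) * h y) μ :=
    Continuous.integrable_of_hasCompactSupport ((hΨc.comp hΩc).mul hhC.continuous) hhs.mul_left
  have hibp := integral_mul_fderiv_eq_neg_fderiv_mul_of_integrable h1 h2 h3
    (fun y _ => hfd y) (fun y _ => hhd y)
  -- `Ψ'(Ω) ∂_vΩ · h = Ψ'(Ω) G` pointwise
  have hprod : ∀ y, fderiv ℝ (fun z => Ψ (Ω z)) y v * h y = Ψ' (Ω y) * G y := by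
    intro y
    rw [hf']
    by_cases hy : y ∈ tsupport G
    · have hq : fderiv ℝ Ω y v ≠ 0 := hv y hy
      rw [hh]
      field_simp
    · rw [image_eq_zero_of_notMem_tsupport hy, hh]
      simp [image_eq_zero_of_notMem_tsupport hy]
  simp only [hprod] at hibp
  -- `hibp : ∫ Ψ(Ω) ∂_v h = −∫ Ψ'(Ω) G`
  rw [hibp, neg_neg]

/-! ### §4 Two integrations by parts: the second-difference bound -/

/-- **Second differences of a pushforward along a transversal direction are `O(δ²)`.** For a `C³`
level function `Ω : V → ℝ`, a `C²` amplitude `G` with compact support, a direction `v` with `∂_v Ω ≠ 0`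
on `tsupport G`, a continuous test function `φ` with `|φ| ≤ 1` and `δ ≥ 0`:
`|∫ G·(2φ(Ω) − φ(Ω+δ) − φ(Ω−δ)) dμ| ≤ δ²·∫ |∂_v((∂_v(G/∂_vΩ))/∂_vΩ)| dμ` — the constant sees no
derivative of `φ`. (Registered sub-goal of stub B1b″ `stub_excursionSecondDifference`.)
[cite: HormanderALPDO1, Thm. 7.7.1] -/
theorem abs_integral_secondDiff_le {Ω G : V → ℝ} (hΩ : ContDiff ℝ 3 Ω) (hG : ContDiff ℝ 2 G)
    (hGs : HasCompactSupport G) {v : V} (hv : ∀ y ∈ tsupport G, fderiv ℝ Ω y v ≠ 0)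
    {φ : ℝ → ℝ} (hφ : Continuous φ) (hφ1 : ∀ x, |φ x| ≤ 1) {δ : ℝ} (hδ : 0 ≤ δ) :
    |∫ y, G y * (2 * φ (Ω y) - φ (Ω y + δ) - φ (Ω y - δ)) ∂μ| ≤
      δ ^ 2 * ∫ y, |fderiv ℝ (fun z => fderiv ℝ (fun w => G w / fderiv ℝ Ω w v) z v /
        fderiv ℝ Ω z v) y v| ∂μ := by
  -- the twice-integrated test function and its second differences
  obtain ⟨Φ, Φ₁, Φ₂, hΦd, hΦ₁d, hΦ₂c, hΦ₂eq, hΦb'⟩ := exists_smoothed_secondDiff φ δ hφ hδ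
  have hΦb : ∀ E, |Φ E| ≤ δ ^ 2 := hΦb' hφ1
  have hΦ₁c : Continuous Φ₁ := continuous_iff_continuousAt.2 fun E => (hΦ₁d E).continuousAt
  -- the two amplitudes
  set G₁ : V → ℝ := fun y => fderiv ℝ (fun z => G z / fderiv ℝ Ω z v) y v with hG₁def
  have hh : ContDiff ℝ 2 fun z => G z / fderiv ℝ Ω z v :=
    sd_contDiff_div (n := 2) (hΩ.of_le (by norm_num)) hG hv
  have hG₁C : ContDiff ℝ 1 G₁ :=
    (hh.fderiv_right (m := 1) (by norm_num)).clm_apply contDiff_const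
  have hG₁s : HasCompactSupport G₁ := (sd_hasCompactSupport_div Ω hGs v).fderiv_apply ℝ v
  have hG₁t : tsupport G₁ ⊆ tsupport G := sd_tsupport_fderiv_div_subset Ω G v
  have hv₁ : ∀ y ∈ tsupport G₁, fderiv ℝ Ω y v ≠ 0 := fun y hy => hv y (hG₁t hy)
  -- first integration by parts: `∫ Φ₂(Ω) G = −∫ Φ₁(Ω) G₁`
  have hstep1 := integral_deriv_comp_mul_eq (μ := μ) hΦ₁d hΦ₂c (hΩ.of_le (by norm_num))
    (hG.of_le (by norm_num)) hGs hv
  -- second integration by parts: `∫ Φ₁(Ω) G₁ = −∫ Φ(Ω) ∂_v(G₁/∂_vΩ)`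
  have hstep2 := integral_deriv_comp_mul_eq (μ := μ) hΦd hΦ₁c (hΩ.of_le (by norm_num))
    hG₁C hG₁s hv₁
  -- the left-hand side is `−∫ Φ₂(Ω) G`
  have hlhs : ∫ y, G y * (2 * φ (Ω y) - φ (Ω y + δ) - φ (Ω y - δ)) ∂μ =
      -∫ y, Φ₂ (Ω y) * G y ∂μ := by
    rw [← integral_neg]
    refine integral_congr_ae (Eventually.of_forall fun y => ?_)
    simp only [hΦ₂eq]
    ring
  rw [hlhs, hstep1, neg_neg, hstep2, abs_neg]
  -- `|∫ Φ(Ω) Q| ≤ δ² ∫ |Q|`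
  set Q : V → ℝ := fun y => fderiv ℝ (fun z => G₁ z / fderiv ℝ Ω z v) y v with hQdef
  have hQC : Continuous Q := by
    have hq : ContDiff ℝ 1 fun z => G₁ z / fderiv ℝ Ω z v :=
      sd_contDiff_div (n := 1) (hΩ.of_le (by norm_num)) hG₁C hv₁
    exact (hq.continuous_fderiv one_ne_zero).clm_apply continuous_const
  have hQs : HasCompactSupport Q := (sd_hasCompactSupport_div Ω hG₁s v).fderiv_apply ℝ v
  have hQi : Integrable Q μ := hQC.integrable_of_hasCompactSupport hQs
  calc |∫ y, Φ (Ω y) * Q y ∂μ| ≤ ∫ y, |Φ (Ω y) * Q y| ∂μ := abs_integral_le_integral_abs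
    _ ≤ ∫ y, δ ^ 2 * |Q y| ∂μ := by
        refine integral_mono_of_nonneg (Eventually.of_forall fun y => abs_nonneg _)
          (hQi.abs.const_mul _) (Eventually.of_forall fun y => ?_)
        show |Φ (Ω y) * Q y| ≤ δ ^ 2 * |Q y|
        rw [abs_mul]
        exact mul_le_mul_of_nonneg_right (hΦb _) (abs_nonneg _)
    _ = δ ^ 2 * ∫ y, |Q y| ∂μ := integral_const_mul _ _

/-- **The chart lemma on `ℝ³` (registered sub-goal `abs_integral_secondDiff_le_volume` of stub B1b″
`stub_excursionSecondDifference`; all binders explicit).** For a `C³` level function `Ω : ℝ³ → ℝ`, a `C²`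
amplitude `G` with compact support, a direction `v` with `∂_v Ω ≠ 0` on `tsupport G`, a continuous test
function `|φ| ≤ 1` and `δ ≥ 0`:
`|∫ G·(2φ(Ω) − φ(Ω+δ) − φ(Ω−δ)) dy| ≤ δ²·∫ |∂_v((∂_v(G/∂_vΩ))/∂_vΩ)| dy` (Lebesgue measure on `ℝ³`).
[cite: HormanderALPDO1, Thm. 7.7.1] -/
theorem abs_integral_secondDiff_le_volume :
    ∀ (Ω G : ℝ × ℝ × ℝ → ℝ) (v : ℝ × ℝ × ℝ) (φ : ℝ → ℝ) (δ : ℝ), ContDiff ℝ 3 Ω → ContDiff ℝ 2 G →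
      HasCompactSupport G → (∀ y ∈ tsupport G, fderiv ℝ Ω y v ≠ 0) → Continuous φ →
      (∀ x, |φ x| ≤ 1) → 0 ≤ δ →
      |∫ y, G y * (2 * φ (Ω y) - φ (Ω y + δ) - φ (Ω y - δ))| ≤
        δ ^ 2 * ∫ y, |fderiv ℝ (fun z => fderiv ℝ (fun w => G w / fderiv ℝ Ω w v) z v /
          fderiv ℝ Ω z v) y v| :=
  fun _ _ _ _ _ hΩ hG hGs hv hφ hφ1 hδ => by
    haveI h2 : (volume : Measure (ℝ × ℝ)).IsAddHaarMeasure := by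
      rw [Measure.volume_eq_prod]; infer_instance
    haveI h3 : (volume : Measure (ℝ × ℝ × ℝ)).IsAddHaarMeasure := by
      rw [Measure.volume_eq_prod]; infer_instance
    exact abs_integral_secondDiff_le hΩ hG hGs hv hφ hφ1 hδ

end Summit.AtomisticToContinuum.FouriersLaw.Theorems.DrudeDissolution.KineticPolymerGasOnTheTimeAxis

end
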